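import Summits.BirchSwinnertonDyer.BirchSwinnertonDyer.Theorems.ThetaPartnerAtTwoSignedControlAtTwoSignedLocalInjEngine
import Literature.NumberTheory.EllipticCurves.IwasawaDualModule
import HarnessLib

/-!
# Route `ThetaPartnerAtTwo` (TP2), crux K3 `SignedKatoDivisibilityUpToAtTwo` (item stmt-BirchSwinnertonDyer-20308),
# line `colemanrat` v3 — THE KUMMER POINT OF A CLASS IS WELL DEFINED MODULO `A`: for the Kummer condition
# `localKummerOverOfEmb W p (ker κ) ι A` cut out by a `p`-SATURATED subgroup `A ≤ E(K_∞·K_v)` of the tower points, two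
# representations `(φ, Q, k)`, `(φ', Q', k')` of the same class have `Q' = Q + ι(t) + D` with `t ∈ E[p^∞]`, `D ∈ A`; hence
# the value `φ_A(p^k Q)/p^k ∈ ℚ_p/ℤ_p` of a functional `φ_A : A → ℤ_p` on the class does not depend on the representation
# — the POINTS-MODEL of the Poitou–Tate map `j : Hom(E^ε(K_∞·K_v), ℤ_p) → X^ε(E/K_∞)` of K3's package is well defined
# (any `K`, `p`, `κ`, `ι`, `A`; at `p = 2` on the habitat (NT) and saturation are tree theorems).

Width seat `bsd-wall-tp2-p2x-w3` g2 (cell `bsd-wall`). HONEST FRAMING: THEOREMS ONLY — no definition, no named fact, no instance,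
no `sorry`; route-independent; closes no item; BSD is NOT proved by any of this.

## Why this file

K3's `2`-robust package (crux file `W3G2_LocalPackageSketch.lean`) has a local module `P` and a map `j : P → X⁺`. In Sprung's /
the tree's POINTS MODEL of the local Iwasawa cohomology («`H¹_Iw(T)` is the group of additive maps `E(K_∞·K_v) →+ ℤ_p`»,
`Sprung2012/ColemanMaps.lean`; the `bsd-2adic` cell's ♭ Coleman map `SSFlatEC.*` at `p = 2` lives there), `P = Hom(E⁺_∞, ℤ_p)` and
`j(φ_A)` is the character `s ↦ φ_A(p^k Q)/p^k (mod ℤ_p)` of `Sel⁺(E/K_∞)`, where `(Q, k)` is a Kummer witness of `s` at `𝔭`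
(`s` Kummer-from-`E⁺_∞`: K4's `SignedEC.signedSelmerInfty_le_localKummerOverOfEmb_iSup_signedLocalPoints`). This file proves that
this recipe does not depend on the witness: the algebraic heart (Kobayashi §2 p. 4, «we regard `E(K_{n,v}) ⊗ ℚ_p/ℤ_p` as a
subgroup of `H¹(K_{n,v}, E[p^∞])` by the Kummer map» — injectivity of the Kummer map needs exactly saturation and no `p`-torsion).

## What is proved

* §1 `mem_of_pow_nsmul_mem_of_saturated` — iterated saturation; `exists_torsion_add_mem_of_kummerReps` — **two Kummer witnesses of
  one class differ by `ι(torsion) + A`**; `exists_pow_nsmul_eq_add_of_kummerReps` — hence `p^N Q' = p^N Q + p^N D` with `D ∈ A` for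
  all large `N`.
* §2 arithmetic of the values `n • (1/p^k) ∈ ℚ/ℤ` (`AddCircle (1 : ℚ)`): `pow_nsmul_invPow_eq`, `pow_nsmul_invPow_self`,
  `val_nsmul_invPow_eq_of_le` (compatibility `k ≤ N`), `toZModPow_val_add_pow_nsmul`.
* §3 `kummerValue_eq_of_kummerReps` — **for every `φ_A : A →+ ℤ_p` the value `(φ_A(p^k Q) mod p^k) • (1/p^k)` is the same for
  any two Kummer witnesses of the same class** (the points-model `j` is well defined).

References: [Kobayashi2003] §2 p. 4 (Kummer embedding), (7.17) (p. 12); [Sprung2012] §1 p. 1486 (points model of `H¹_Iw`);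
[SilvermanAEC2009] VIII §2, X §4 (Kummer pairing); [Washington1997] §13.2.
-/

set_option autoImplicit false
-- the Theorems namespace of this sub repeats the summit name by design (D-0017 nested layout)
set_option linter.dupNamespace false

noncomputable section

open scoped Classical

namespace Summit.BirchSwinnertonDyer.BirchSwinnertonDyer.Theorems

namespace SignedKatoOffTwo.KummerPoint

open NumberField IsDedekindDomain Field WeierstrassCurve
  Literature.NumberTheory.EllipticCurves Literature.NumberTheory.EllipticCurves.Kobayashi2003
  Literature.NumberTheory.EllipticCurves.Sprung2012 Literature.NumberTheory.GaloisRepresentations ZpExtension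

universe u

/-! ## §1 Two Kummer witnesses of one class -/

section Reps

variable {K : Type u} [Field K] (W : WeierstrassCurve K) (p : ℕ) [Fact p.Prime] (κ : ZpExtension K p)
  {E : Type u} [Field E] [Algebra K E] (ι : AlgebraicClosure K →ₐ[K] AlgebraicClosure E)

/-- Iterated saturation: if `A` is `p`-saturated in the tower `M = E(K_∞·K_v)`, then `p^N • y ∈ A`, `y ∈ M` force `y ∈ A`. [folklore] -/
theorem mem_of_pow_nsmul_mem_of_saturated (A : AddSubgroup (localPoints W E))
    (hsat : ∀ y ∈ localTowerPointsOfEmb κ ι W, p • y ∈ A → y ∈ A) {N : ℕ} {y : localPoints W E}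
    (hy : y ∈ localTowerPointsOfEmb κ ι W) (hNy : p ^ N • y ∈ A) : y ∈ A := by
  induction N generalizing y with
  | zero => rwa [pow_zero, one_smul] at hNy
  | succ N ih =>
    refine ih hy (hsat _ (AddSubgroup.nsmul_mem _ hy _) ?_)
    rwa [smul_smul, ← pow_succ']

/-- **Two Kummer witnesses of the same class differ by `ι(torsion) + A`.** Let `A ≤ E(K_∞·K_v)` be `p`-saturated in the tower and let
`(φ, Q, k)`, `(φ', Q', k')` be two witnesses (as in `Kobayashi2003.mem_localKummerOverOfEmb_iff`) of ONE class of `H¹(K_∞, E[p^∞])`: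
`[φ] = [φ']`, `p^k Q ∈ A`, `p^{k'} Q' ∈ A`, `ι(φ τ) = τQ − Q` and `ι(φ' τ) = τQ' − Q'` on `Gal(K̄_v/K_∞·K_v)`. Then `Q' = Q + ι(t) + D`
for some `t ∈ E[p^∞](K̄)` and `D ∈ A` (`φ' − φ = ∂t`; `D := Q' − Q − ι t` is fixed by the local group, hence a tower point, and
`p^N D ∈ A` for large `N`, hence `D ∈ A` by saturation). [cite: Kobayashi2003, §2 p. 4] [cite: SilvermanAEC2009, VIII §2, X §4] -/
theorem exists_torsion_add_mem_of_kummerReps (A : AddSubgroup (localPoints W E))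
    (hsat : ∀ y ∈ localTowerPointsOfEmb κ ι W, p • y ∈ A → y ∈ A)
    {φ φ' : contOneCocycles (discreteTopRep κ.kerSubgroup (W.geomPrimaryTorsion p))}
    (hφφ' : oneCocycleClass _ φ = oneCocycleClass _ φ') {Q Q' : localPoints W E} {k k' : ℕ}
    (hQ : p ^ k • Q ∈ A) (hQ' : p ^ k' • Q' ∈ A)
    (hτ : ∀ τ : localSubgroupOfEmb κ.kerSubgroup ι,
      pointsMapOfEmb W ι ((φ.1 (resGalSubgroupOfEmb κ.kerSubgroup ι τ) : W.geomPrimaryTorsion p) : W.geomPoints) =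
        (τ : Field.absoluteGaloisGroup E) • Q - Q)
    (hτ' : ∀ τ : localSubgroupOfEmb κ.kerSubgroup ι,
      pointsMapOfEmb W ι ((φ'.1 (resGalSubgroupOfEmb κ.kerSubgroup ι τ) : W.geomPrimaryTorsion p) : W.geomPoints) =
        (τ : Field.absoluteGaloisGroup E) • Q' - Q') :
    ∃ (t : W.geomPrimaryTorsion p) (D : localPoints W E), D ∈ A ∧
      Q' = Q + pointsMapOfEmb W ι (t : W.geomPoints) + D := by
  -- `φ' − φ = ∂t`
  have h0 : oneCocycleClass _ (φ' - φ) = 0 := by rw [oneCocycleClass_sub, ← hφφ', sub_self]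
  rw [oneCocycleClass_eq_zero_iff] at h0
  obtain ⟨t, ht⟩ := h0
  have ht' : ∀ g : κ.kerSubgroup, (φ'.1 g : W.geomPrimaryTorsion p) = φ.1 g + ((g : Field.absoluteGaloisGroup K) • t - t) := by
    intro g
    have h1 := ht g
    rw [Submodule.coe_sub, ContinuousMap.sub_apply, sub_eq_iff_eq_add, discreteTopRep_ρ_apply, Subgroup.smul_def] at h1
    rw [h1, add_comm]
  -- `D := Q' − Q − ι t` is a tower point
  set D : localPoints W E := Q' - Q - pointsMapOfEmb W ι (t : W.geomPoints) with hD
  have hDM : D ∈ localTowerPointsOfEmb κ ι W := by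
    rw [mem_localTowerPointsOfEmb_iff]
    intro τ hτmem
    have e1 := hτ ⟨τ, hτmem⟩
    have e2 := hτ' ⟨τ, hτmem⟩
    rw [ht' _, AddSubgroup.coe_add, map_add, e1, AddSubgroup.coe_sub, map_sub, primaryComponent.coe_smul,
      resGalSubgroupOfEmb_apply_coe, pointsMapOfEmb_smul] at e2
    -- `e2 : τQ − Q + (τ ιt − ιt) = τQ' − Q'`
    rw [hD, smul_sub, smul_sub, ← sub_eq_zero]
    have : (τ : Field.absoluteGaloisGroup E) • Q' - Q' - ((τ • Q - Q) +
        (τ • pointsMapOfEmb W ι (t : W.geomPoints) - pointsMapOfEmb W ι (t : W.geomPoints))) = 0 := by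
      rw [← e2, sub_self]
    rw [← this]
    abel
  -- a power of `p` killing `t`
  obtain ⟨m, hm⟩ : ∃ m : ℕ, p ^ m • (t : W.geomPoints) = 0 := AddCommGroup.mem_primaryComponent.mp t.2
  -- `p^N D ∈ A` for `N = k + k' + m`
  have hND : p ^ (k + k' + m) • D ∈ A := by
    have h1 : p ^ (k + k' + m) • Q' ∈ A := by
      rw [show k + k' + m = (k + m) + k' by ring, pow_add, mul_smul]
      exact AddSubgroup.nsmul_mem _ hQ' _
    have h2 : p ^ (k + k' + m) • Q ∈ A := by
      rw [show k + k' + m = (k' + m) + k by ring, pow_add, mul_smul]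
      exact AddSubgroup.nsmul_mem _ hQ _
    have h3 : p ^ (k + k' + m) • pointsMapOfEmb W ι (t : W.geomPoints) = 0 := by
      rw [pow_add, mul_smul, ← map_nsmul (pointsMapOfEmb W ι) (p ^ m), hm, map_zero, smul_zero]
    rw [hD, smul_sub, smul_sub, h3, sub_zero]
    exact sub_mem h1 h2
  refine ⟨t, D, mem_of_pow_nsmul_mem_of_saturated W p κ ι A hsat hDM hND, ?_⟩
  rw [hD]
  abel

/-- **`p^N Q' = p^N Q + p^N D` with `D ∈ A`** for every `N ≥ k + k' + (torsion exponent)`: the multiplicative form of the previous lemma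
used by functionals (the torsion term dies). Packaged: `∃ D ∈ A, ∃ N₀, ∀ N ≥ N₀, p^N • Q' = p^N • Q + p^N • D`, with `k, k' ≤ N₀`.
[cite: Kobayashi2003, §2 p. 4] -/
theorem exists_pow_nsmul_eq_add_of_kummerReps (A : AddSubgroup (localPoints W E))
    (hsat : ∀ y ∈ localTowerPointsOfEmb κ ι W, p • y ∈ A → y ∈ A)
    {φ φ' : contOneCocycles (discreteTopRep κ.kerSubgroup (W.geomPrimaryTorsion p))}
    (hφφ' : oneCocycleClass _ φ = oneCocycleClass _ φ') {Q Q' : localPoints W E} {k k' : ℕ}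
    (hQ : p ^ k • Q ∈ A) (hQ' : p ^ k' • Q' ∈ A)
    (hτ : ∀ τ : localSubgroupOfEmb κ.kerSubgroup ι,
      pointsMapOfEmb W ι ((φ.1 (resGalSubgroupOfEmb κ.kerSubgroup ι τ) : W.geomPrimaryTorsion p) : W.geomPoints) =
        (τ : Field.absoluteGaloisGroup E) • Q - Q)
    (hτ' : ∀ τ : localSubgroupOfEmb κ.kerSubgroup ι,
      pointsMapOfEmb W ι ((φ'.1 (resGalSubgroupOfEmb κ.kerSubgroup ι τ) : W.geomPrimaryTorsion p) : W.geomPoints) =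
        (τ : Field.absoluteGaloisGroup E) • Q' - Q') :
    ∃ D ∈ A, ∃ N₀ : ℕ, k ≤ N₀ ∧ k' ≤ N₀ ∧ ∀ N, N₀ ≤ N → p ^ N • Q' = p ^ N • Q + p ^ N • D := by
  obtain ⟨t, D, hDA, hQ'⟩ := exists_torsion_add_mem_of_kummerReps W p κ ι A hsat hφφ' hQ hQ' hτ hτ'
  obtain ⟨m, hm⟩ : ∃ m : ℕ, p ^ m • (t : W.geomPoints) = 0 := AddCommGroup.mem_primaryComponent.mp t.2
  refine ⟨D, hDA, k + k' + m, by omega, by omega, fun N hN ↦ ?_⟩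
  have h3 : p ^ N • pointsMapOfEmb W ι (t : W.geomPoints) = 0 := by
    obtain ⟨d, hd⟩ := Nat.exists_eq_add_of_le hN
    rw [hd, show k + k' + m + d = (k + k' + d) + m by ring, pow_add, mul_smul, ← map_nsmul (pointsMapOfEmb W ι) (p ^ m),
      hm, map_zero, smul_zero]
  rw [hQ', smul_add, smul_add, h3, add_zero]

end Reps

/-! ## §2 The values `n • (1/p^k) ∈ ℚ/ℤ` -/

section Values

variable (p : ℕ) [Fact p.Prime]

/-- `p^{N−k} • (1/p^N) = 1/p^k` in `ℚ/ℤ` (`k ≤ N`). [folklore] -/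
theorem pow_nsmul_invPow_eq {k N : ℕ} (h : k ≤ N) :
    p ^ (N - k) • ((((p : ℚ) ^ N)⁻¹ : ℚ) : AddCircle (1 : ℚ)) = ((((p : ℚ) ^ k)⁻¹ : ℚ) : AddCircle (1 : ℚ)) := by
  have hp : (p : ℚ) ≠ 0 := Nat.cast_ne_zero.2 (Fact.out : p.Prime).ne_zero
  rw [← AddCircle.coe_nsmul]
  congr 1
  obtain ⟨d, rfl⟩ := Nat.exists_eq_add_of_le h
  rw [Nat.add_sub_cancel_left, nsmul_eq_mul, pow_add, mul_inv, Nat.cast_pow, ← mul_assoc, mul_comm ((p : ℚ) ^ d),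
    mul_assoc, mul_inv_cancel₀ (pow_ne_zero d hp), mul_one]

/-- `p^N • (1/p^N) = 0` in `ℚ/ℤ`. [folklore] -/
theorem pow_nsmul_invPow_self (N : ℕ) : p ^ N • ((((p : ℚ) ^ N)⁻¹ : ℚ) : AddCircle (1 : ℚ)) = 0 := by
  have hp : (p : ℚ) ≠ 0 := Nat.cast_ne_zero.2 (Fact.out : p.Prime).ne_zero
  rw [← AddCircle.coe_nsmul, nsmul_eq_mul, Nat.cast_pow, mul_inv_cancel₀ (pow_ne_zero N hp), AddCircle.coe_period]

/-- For `X ∈ ℤ/M` (`M ≠ 0`) and `n : ℕ`, `(n • X).val ≡ n · X.val (mod M)`. [folklore] -/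
theorem val_nsmul_modEq {M : ℕ} [NeZero M] (n : ℕ) (X : ZMod M) : (n • X).val ≡ n * X.val [MOD M] := by
  rw [nsmul_eq_mul, ZMod.val_mul, ZMod.val_natCast]
  exact (Nat.mod_modEq _ _).trans ((Nat.mod_modEq _ _).mul_right _)

/-- **Compatibility of the value in `k`**: for `x ∈ ℤ_p` and `k ≤ N`, `((p^{N−k} x) mod p^N) • (1/p^N) = (x mod p^k) • (1/p^k)` in `ℚ/ℤ`.
[folklore] -/
theorem val_nsmul_invPow_eq_of_le {k N : ℕ} (h : k ≤ N) (x : ℤ_[p]) :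
    (PadicInt.toZModPow N (p ^ (N - k) • x)).val • ((((p : ℚ) ^ N)⁻¹ : ℚ) : AddCircle (1 : ℚ)) =
      (PadicInt.toZModPow k x).val • ((((p : ℚ) ^ k)⁻¹ : ℚ) : AddCircle (1 : ℚ)) := by
  have hN0 : p ^ N • ((((p : ℚ) ^ N)⁻¹ : ℚ) : AddCircle (1 : ℚ)) = 0 := pow_nsmul_invPow_self p N
  have hk0 : p ^ k • ((((p : ℚ) ^ k)⁻¹ : ℚ) : AddCircle (1 : ℚ)) = 0 := pow_nsmul_invPow_self p k
  haveI : NeZero (p ^ N) := ⟨pow_ne_zero N (Fact.out : p.Prime).ne_zero⟩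
  -- `toZModPow N (p^{N−k} • x) = p^{N−k} • toZModPow N x`
  rw [map_nsmul, IwasawaDual.smul_eq_of_modEq hN0 (val_nsmul_modEq (p ^ (N - k)) (PadicInt.toZModPow N x)),
    mul_comm, mul_smul, pow_nsmul_invPow_eq p h]
  -- `(toZModPow N x).val • (1/p^k) = (toZModPow k x).val • (1/p^k)` on the `p^k`-torsion element `1/p^k`
  have hz := IwasawaDual.zpT_of_le h hk0 x
  rw [IwasawaDual.zpT_def, IwasawaDual.zpT_def] at hz
  exact hz

/-- Adding a multiple of `p^N` inside does not change the value at level `N`. [folklore] -/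
theorem toZModPow_add_pow_nsmul (N : ℕ) (x y : ℤ_[p]) :
    PadicInt.toZModPow N (x + p ^ N • y) = PadicInt.toZModPow N x := by
  haveI : NeZero (p ^ N) := ⟨pow_ne_zero N (Fact.out : p.Prime).ne_zero⟩
  rw [map_add, map_nsmul, nsmul_eq_mul, ZMod.natCast_self, zero_mul, add_zero]

end Values

/-! ## §3 The value of a functional on a Kummer class does not depend on the witness -/

section Value

variable {K : Type u} [Field K] (W : WeierstrassCurve K) (p : ℕ) [Fact p.Prime] (κ : ZpExtension K p)
  {E : Type u} [Field E] [Algebra K E] (ι : AlgebraicClosure K →ₐ[K] AlgebraicClosure E)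

/-- Raising the exponent of ONE witness: `(φ_A(p^N Q) mod p^N) • (1/p^N) = (φ_A(p^k Q) mod p^k) • (1/p^k)` for `k ≤ N`.
[cite: Kobayashi2003, §2 p. 4] -/
theorem kummerValue_eq_of_le (A : AddSubgroup (localPoints W E)) (φA : A →+ ℤ_[p]) {Q : localPoints W E} {k N : ℕ}
    (h : k ≤ N) (hQ : p ^ k • Q ∈ A) (hQN : p ^ N • Q ∈ A) :
    (PadicInt.toZModPow N (φA ⟨p ^ N • Q, hQN⟩)).val • ((((p : ℚ) ^ N)⁻¹ : ℚ) : AddCircle (1 : ℚ)) =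
      (PadicInt.toZModPow k (φA ⟨p ^ k • Q, hQ⟩)).val • ((((p : ℚ) ^ k)⁻¹ : ℚ) : AddCircle (1 : ℚ)) := by
  have e : (⟨p ^ N • Q, hQN⟩ : A) = p ^ (N - k) • (⟨p ^ k • Q, hQ⟩ : A) := by
    apply Subtype.ext
    rw [AddSubgroupClass.coe_nsmul, smul_smul, ← pow_add, Nat.sub_add_cancel h]
  rw [e, map_nsmul]
  exact val_nsmul_invPow_eq_of_le p h _

/-- **The points-model Poitou–Tate value is well defined.** For `A ≤ E(K_∞·K_v)` `p`-saturated in the tower, any functional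
`φ_A : A →+ ℤ_p`, and two Kummer witnesses `(φ, Q, k)`, `(φ', Q', k')` of ONE class of `H¹(K_∞, E[p^∞])` relative to `A`:
`(φ_A(p^k Q) mod p^k) • (1/p^k) = (φ_A(p^{k'} Q') mod p^{k'}) • (1/p^{k'})` in `ℚ/ℤ = AddCircle (1 : ℚ)`. So `s ↦ φ_A(p^k Q)/p^k` is a
well-defined character of the Kummer-from-`A` classes — the map `j : Hom(A, ℤ_p) → Hom(Sel^ε_∞, ℚ/ℤ)` of K3's package in the points
model (with `A = ⨆ₙ E^ε(K_n·K_v)`). [cite: Kobayashi2003, §2 p. 4, (7.17) (p. 12)] [cite: Sprung2012, §1 p. 1486] -/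
theorem kummerValue_eq_of_kummerReps (A : AddSubgroup (localPoints W E))
    (hsat : ∀ y ∈ localTowerPointsOfEmb κ ι W, p • y ∈ A → y ∈ A)
    (φA : A →+ ℤ_[p])
    {φ φ' : contOneCocycles (discreteTopRep κ.kerSubgroup (W.geomPrimaryTorsion p))}
    (hφφ' : oneCocycleClass _ φ = oneCocycleClass _ φ') {Q Q' : localPoints W E} {k k' : ℕ}
    (hQ : p ^ k • Q ∈ A) (hQ' : p ^ k' • Q' ∈ A)
    (hτ : ∀ τ : localSubgroupOfEmb κ.kerSubgroup ι,
      pointsMapOfEmb W ι ((φ.1 (resGalSubgroupOfEmb κ.kerSubgroup ι τ) : W.geomPrimaryTorsion p) : W.geomPoints) =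
        (τ : Field.absoluteGaloisGroup E) • Q - Q)
    (hτ' : ∀ τ : localSubgroupOfEmb κ.kerSubgroup ι,
      pointsMapOfEmb W ι ((φ'.1 (resGalSubgroupOfEmb κ.kerSubgroup ι τ) : W.geomPrimaryTorsion p) : W.geomPoints) =
        (τ : Field.absoluteGaloisGroup E) • Q' - Q') :
    (PadicInt.toZModPow k (φA ⟨p ^ k • Q, hQ⟩)).val • ((((p : ℚ) ^ k)⁻¹ : ℚ) : AddCircle (1 : ℚ)) =
      (PadicInt.toZModPow k' (φA ⟨p ^ k' • Q', hQ'⟩)).val • ((((p : ℚ) ^ k')⁻¹ : ℚ) : AddCircle (1 : ℚ)) := by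
  obtain ⟨D, hDA, N₀, hk, hk', hN⟩ := exists_pow_nsmul_eq_add_of_kummerReps W p κ ι A hsat hφφ' hQ hQ' hτ hτ'
  have hQN : p ^ N₀ • Q ∈ A := by
    obtain ⟨d, hd⟩ := Nat.exists_eq_add_of_le hk
    rw [hd, pow_add, mul_comm, mul_smul]; exact AddSubgroup.nsmul_mem _ hQ _
  have hQ'N : p ^ N₀ • Q' ∈ A := by
    obtain ⟨d, hd⟩ := Nat.exists_eq_add_of_le hk'
    rw [hd, pow_add, mul_comm, mul_smul]; exact AddSubgroup.nsmul_mem _ hQ' _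
  rw [← kummerValue_eq_of_le W p A φA hk hQ hQN, ← kummerValue_eq_of_le W p A φA hk' hQ' hQ'N]
  -- at the common level `N₀`: `φ_A(p^N₀ Q') = φ_A(p^N₀ Q) + p^N₀ φ_A(D)`
  have e : (⟨p ^ N₀ • Q', hQ'N⟩ : A) = ⟨p ^ N₀ • Q, hQN⟩ + p ^ N₀ • ⟨D, hDA⟩ := by
    apply Subtype.ext
    rw [AddSubgroup.coe_add, AddSubgroupClass.coe_nsmul]
    exact hN N₀ le_rfl
  rw [e, map_add, map_nsmul, toZModPow_add_pow_nsmul]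

end Value

end SignedKatoOffTwo.KummerPoint

end Summit.BirchSwinnertonDyer.BirchSwinnertonDyer.Theorems

end
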